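import Summits.AtomisticToContinuum.Crystallization.Theorems.FrustratedLawDichotomyGSCClusterExactness

/-!
# FrustratedLawDichotomy · crux `AperiodicFrustratedLawGap` (stmt-AtomisticToContinuum-27623) — CONCORDANCE EDGE: the priced finite gap
# `PricedLinkCensus.ChargedEnergyGap` (stmt-14231) prices the law-free residual: under it, exact μ-equilibria are asymptotically CHARGE-FREE
# (configuration level; decomp-a2c, prover hand 2, structural share, generation 6)

Cluster exactness (`FrustratedLawDichotomyGSCClusterExactness`, this generation) pins the internal excess of every finite cluster `C` of an
`e⋆`-μ-ground-state configuration `X` of Lennard-Jones: `0 ≤ U(C) − n·e⋆ ≤ −I(C, X∖C)`.  The hinge crux of route `PricedLinkCensus`,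
`ChargedEnergyGap` (item stmt-AtomisticToContinuum-14231, OPEN; tree: `ChargedEnergyGapNegative.chargedEnergyGap_iff_price` — the boundary
allowance `C·N^(2/3)` is not load-bearing), prices that excess from below by `κ · #{sites of C not charge-free at tolerance 1/100}`
(`Literature.Geometry.DiscreteGeometry.IsChargeFree`: twelve `1/100`-bonds, every bond with ring number `4` — the fcc/hcp link).  Hence:

* `charged_le_neg_cross_of_price`   : for every price `κ` as in `chargedEnergyGap_iff_price` and every finite cluster `C ⊆ X` of an
  `e⋆`-μGSC:  `κ · charged_{1/100}(C) ≤ −I(C, X∖C)` — the number of charged sites of a cluster is controlled by its BINDING TO THE REST alone;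
* `charged_le_neg_cross_of_chargedEnergyGap` : the same read off the crux BY NAME (`∃ κ > 0, …`);
* `exists_isChargeFree_of_neg_cross_lt` : a cluster bound to the rest by less than `κ·n` contains a charge-free site;
* `tendsto_chargedFraction_zero_of_price` / `…_of_chargedEnergyGap` : along ANY van Hove family of clusters (`I(C_j, X∖C_j)/n_j → 0`) the
  charged fraction `charged(C_j)/n_j → 0` — under `ChargedEnergyGap`, an exact μ-equilibrium is ASYMPTOTICALLY ALL-CHARGE-FREE.

Reading for item 27623 (repair census, cross-lineage): the residual's hypothetical `X` is everywhere `1/20`-BAD (texture clause (2)), so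
`R_GSC^aper` (and `R_GSC^per`) follow from `ChargedEnergyGap` once (I-RIG) «a site that is charge-free at `1/100` in a `7/10`-separated
configuration has an fcc/hcp kissing pattern within `1/20`» (finite-dimensional rigidity of the spoked (anti)cuboctahedron framework with `1 %`
bars: amplification factor `< 5` wanted — a census instrument) and (VH) «every infinite `δ`-separated `X` has a van Hove family of finite
clusters» (dyadic-shell pigeonhole, size M) are supplied; both are named, not assumed here.  This module is `[folklore]` bookkeeping; the
crux `ChargedEnergyGap` enters only as a hypothesis BY NAME.
-/

noncomputable section

namespace Summit.AtomisticToContinuum.Crystallization.Theorems.FrustratedLawDichotomyGSCChargedGapBridge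

open Filter Topology
open Literature.MathematicalPhysics.StatisticalMechanics
open Literature.Geometry.DiscreteGeometry (IsChargeFree)
open Summit.AtomisticToContinuum.Crystallization.Theses.PricedLinkCensus (ChargedEnergyGap)
open Summit.AtomisticToContinuum.Crystallization.Theorems.ChargedEnergyGapNegative (E3 eStar charged chargedEnergyGap_iff_price)
open Summit.AtomisticToContinuum.Crystallization.Theorems.FrustratedLawDichotomyGSCClusterExactness
  (excess_le_neg_cross cross_nonpos_of_isMuGSC)

variable {X : Set E3}

/-- **CHARGED SITES ARE PAID FOR BY THE BINDING TO THE REST.**  If `κ > 0` prices charged sites uniformly on the excess energy of finite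
configurations (`κ·charged_{1/100}(y) ≤ U(y) − N·e⋆`, the price form of `ChargedEnergyGap`), then every finite cluster `C = xf(Fin n)` of an
`e⋆`-μGSC `X` of `V_LJ` has `κ · charged_{1/100}(C) ≤ −I(C, X∖C)`. [folklore] -/
theorem charged_le_neg_cross_of_price {κ : ℝ}
    (hκ : ∀ (N : ℕ) (y : Fin N → E3), Function.Injective y →
      κ * (charged (1 / 100) y : ℝ) ≤ interactionEnergy lennardJones y - (N : ℝ) * eStar)
    (h : IsMuGSC lennardJones eStar X) {n : ℕ} {xf : Fin n → E3} (hxf : Function.Injective xf) (hX : Set.range xf ⊆ X) :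
    κ * (charged (1 / 100) xf : ℝ) ≤ -∑ i, ∑' y : ↥(X \ Set.range xf), lennardJones (dist (xf i) y) :=
  (hκ n xf hxf).trans (excess_le_neg_cross h hxf hX)

/-- **The same, from the crux `ChargedEnergyGap` BY NAME**: some `κ > 0` bounds `κ · charged_{1/100}(C) ≤ −I(C, X∖C)` for every finite
cluster of every `e⋆`-μGSC of `V_LJ`. [folklore] -/
theorem charged_le_neg_cross_of_chargedEnergyGap (hgap : ChargedEnergyGap) :
    ∃ κ : ℝ, 0 < κ ∧ ∀ X : Set E3, IsMuGSC lennardJones eStar X → ∀ (n : ℕ) (xf : Fin n → E3), Function.Injective xf →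
      Set.range xf ⊆ X → κ * (charged (1 / 100) xf : ℝ) ≤ -∑ i, ∑' y : ↥(X \ Set.range xf), lennardJones (dist (xf i) y) := by
  obtain ⟨κ, hκ, hprice⟩ := chargedEnergyGap_iff_price.1 hgap
  exact ⟨κ, hκ, fun X h n xf hxf hX => charged_le_neg_cross_of_price hprice h hxf hX⟩

/-- **A weakly bound cluster contains a charge-free site**: if `−I(C, X∖C) < κ·n` then some atom of `C` is charge-free at `1/100` (in `C`).
[folklore] -/
theorem exists_isChargeFree_of_neg_cross_lt {κ : ℝ}
    (hκ : ∀ (N : ℕ) (y : Fin N → E3), Function.Injective y →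
      κ * (charged (1 / 100) y : ℝ) ≤ interactionEnergy lennardJones y - (N : ℝ) * eStar)
    (h : IsMuGSC lennardJones eStar X) {n : ℕ} {xf : Fin n → E3} (hxf : Function.Injective xf) (hX : Set.range xf ⊆ X)
    (hlt : -∑ i, ∑' y : ↥(X \ Set.range xf), lennardJones (dist (xf i) y) < κ * n) :
    ∃ i : Fin n, IsChargeFree (1 / 100 : ℝ) xf i := by
  by_contra hnone
  push Not at hnone
  have hall : charged (1 / 100) xf = n := by
    unfold charged
    rw [Nat.card_congr (Equiv.subtypeUnivEquiv hnone), Nat.card_eq_fintype_card, Fintype.card_fin]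
  have key := charged_le_neg_cross_of_price hκ h hxf hX
  rw [hall] at key
  exact absurd (key.trans_lt hlt) (lt_irrefl _)

/-- The charged fraction of a finite cluster lies in `[0, 1]` … (non-negativity is all we need below). [folklore] -/
theorem chargedFraction_nonneg {n : ℕ} (xf : Fin n → E3) : 0 ≤ (charged (1 / 100) xf : ℝ) / (n : ℝ) := by
  positivity

/-- **ASYMPTOTICALLY CHARGE-FREE (price form).**  Along any family of finite clusters `C_j = xf_j(Fin n_j) ⊆ X` of an `e⋆`-μGSC of `V_LJ`
whose binding per atom `I(C_j, X∖C_j)/n_j` tends to `0` (van Hove clusters), the charged fraction tends to `0`: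
`charged_{1/100}(C_j)/n_j → 0`. [folklore] -/
theorem tendsto_chargedFraction_zero_of_price {κ : ℝ} (hκpos : 0 < κ)
    (hκ : ∀ (N : ℕ) (y : Fin N → E3), Function.Injective y →
      κ * (charged (1 / 100) y : ℝ) ≤ interactionEnergy lennardJones y - (N : ℝ) * eStar)
    (h : IsMuGSC lennardJones eStar X) {ι : Type*} {l : Filter ι} (n : ι → ℕ) (xf : ∀ j, Fin (n j) → E3)
    (hxf : ∀ j, Function.Injective (xf j)) (hX : ∀ j, Set.range (xf j) ⊆ X) (hn : ∀ j, 0 < n j)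
    (hI : Tendsto (fun j => (∑ i, ∑' y : ↥(X \ Set.range (xf j)), lennardJones (dist (xf j i) y)) / (n j : ℝ)) l (𝓝 0)) :
    Tendsto (fun j => (charged (1 / 100) (xf j) : ℝ) / (n j : ℝ)) l (𝓝 0) := by
  have hupper : Tendsto (fun j => κ⁻¹ * -((∑ i, ∑' y : ↥(X \ Set.range (xf j)), lennardJones (dist (xf j i) y)) / (n j : ℝ)))
      l (𝓝 0) := by
    have := (hI.neg).const_mul κ⁻¹
    simpa only [neg_zero, mul_zero] using this
  refine tendsto_of_tendsto_of_tendsto_of_le_of_le tendsto_const_nhds hupper (fun j => chargedFraction_nonneg (xf j)) (fun j => ?_)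
  have hnj : (0 : ℝ) < n j := by exact_mod_cast hn j
  have key := charged_le_neg_cross_of_price hκ h (hxf j) (hX j)
  rw [← neg_div, ← mul_div_assoc, div_le_div_iff_of_pos_right hnj, le_inv_mul_iff₀ hκpos]
  exact key

/-- **ASYMPTOTICALLY CHARGE-FREE, from `ChargedEnergyGap` BY NAME.**  Under the priced finite gap of route `PricedLinkCensus`, every
`e⋆`-μ-ground-state configuration of Lennard-Jones is asymptotically all-charge-free along every van Hove family of clusters — whereas the
residual configuration of item 27623 is everywhere `1/20`-bad. [folklore] -/
theorem tendsto_chargedFraction_zero_of_chargedEnergyGap (hgap : ChargedEnergyGap)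
    (h : IsMuGSC lennardJones eStar X) {ι : Type*} {l : Filter ι} (n : ι → ℕ) (xf : ∀ j, Fin (n j) → E3)
    (hxf : ∀ j, Function.Injective (xf j)) (hX : ∀ j, Set.range (xf j) ⊆ X) (hn : ∀ j, 0 < n j)
    (hI : Tendsto (fun j => (∑ i, ∑' y : ↥(X \ Set.range (xf j)), lennardJones (dist (xf j i) y)) / (n j : ℝ)) l (𝓝 0)) :
    Tendsto (fun j => (charged (1 / 100) (xf j) : ℝ) / (n j : ℝ)) l (𝓝 0) := by
  obtain ⟨κ, hκ, hprice⟩ := chargedEnergyGap_iff_price.1 hgap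
  exact tendsto_chargedFraction_zero_of_price hκ hprice h n xf hxf hX hn hI

end Summit.AtomisticToContinuum.Crystallization.Theorems.FrustratedLawDichotomyGSCChargedGapBridge

end
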